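import Literature.Combinatorics.SimpleGraph.MengerTheorem
import Literature.Combinatorics.SimpleGraph.TreeDecompositionPetals
import HarnessLib

/-!
# One side of a minimum separation: Menger paths and the half decomposition (tree-width duality, II)

Topic `Literature/Combinatorics/SimpleGraph`; sequel of `TreeDecompositionPetals.lean`, first
half of the technical heart of Mazoit's proof of the Seymour–Thomas tree-width duality theorem as
printed in Diestel's 5th edition (Thm. 12.4.3, claim (∗)): the work done on ONE side of a minimum
separation — Menger paths from the separator into the petal's neighbourhood, and the new bags (1)
they define on the far side. The two sides are put together in `TreewidthDualityGlue.lean`.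

* `Walk.exists_firstHit` — the prefix of a walk up to its first vertex in a set;
* `outNbrs G X` — `N(X)`, the neighbours of `X` outside `X`;
* `SideData G` — one side of a minimum separation seen from its petal `X`: the open side `R ⊇ X`
  (closed under neighbours off the separator `S`) and the minimality of `S`;
  `SideData.card_le_of_isVxSeparator` (the Menger hypothesis: every set separating `Rᶜ` from
  `X ∪ N(X)` has `≥ |S|` vertices) and `SideData.exists_paths` (by the tree's Menger theorem,
  `MengerTheorem.lean`: disjoint paths `P_s`, `s ∈ S`, from `s` into `N(X)` inside `R ∪ {s}`);
* `SideData.halfBag D P t = (V_t ∩ Rᶜ) ∪ {s ∈ S | V_t meets P_s}` — the bags (1) of Diestel's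
  proof (the decomposition induced on the minor contracting the paths), with: node sets linked
  (`linked_halfBag`), edges and vertices of the far side covered, `|V'_t| ≤ |V_t|`
  (`card_halfBag_le`, the injection `s ↦` a vertex of `P_s` in `V_t ∖ B`), `V'_x = S` at the
  trimmed leaf (`halfBag_leaf`), and petals of the new bags lie off `R ∪ S` inside old petals
  (`mem_of_mem_halfBag_sdiff`);

Deviation from the printed text: instead of contracting the paths to a minor and invoking the
induced decomposition (Diestel's Lemmas 12.3.2–12.3.3), the bags (1) are written down directly and
the tree-decomposition axioms are verified for them; and the leaf bag is assumed trimmed to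
`X ∪ N(X)` (hypothesis `htrim`, discharged in `TreewidthDuality.lean` by `trimLeaf`).

## References

* [Diestel2017] R. Diestel, *Graph Theory*, 5th ed. (2017), Thm. 12.4.3, proof of (∗) (and
  Thm. 3.3.1, Menger). Read: galaxy `panama:346492191637568`, chars 1024985–1046000.
* F. Mazoit, *A simple proof of the tree-width duality theorem*, arXiv:1309.2266 (2013), Lemma 1.
* [SeymourThomas1993] P. D. Seymour, R. Thomas, J. Combin. Theory Ser. B 58 (1993) 22–33.
-/

namespace Literature.Combinatorics.SimpleGraph

open _root_.SimpleGraph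
open Literature.ModelTheory.FiniteModelTheory.Dvorak2010 (Linked)

universe u

variable {V : Type u} {G : _root_.SimpleGraph V}

/-! ### Walks: the prefix up to the first vertex in a set -/

/-- **First hit.** A walk ending in `T` has a prefix ending at its first vertex `d` in `T`: all
other vertices of the prefix lie outside `T`, and unless the walk starts in `T` the vertex before
`d` is a vertex outside `T` adjacent to `d`. [folklore] -/
theorem Walk.exists_firstHit (T : Set V) :
    ∀ {a b : V} (W : G.Walk a b), b ∈ T →
      ∃ (d : V) (W₁ : G.Walk a d), d ∈ T ∧ (∀ z ∈ W₁.support, z ∈ T → z = d) ∧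
        (∀ z ∈ W₁.support, z ∈ W.support) ∧ (a = d ∨ ∃ p ∈ W₁.support, p ∉ T ∧ G.Adj p d)
  | a, _, Walk.nil, hb => ⟨a, Walk.nil, hb, fun z hz _ => by simpa using hz, fun z hz => hz, Or.inl rfl⟩
  | a, b, Walk.cons (v := c) h W', hb => by
    classical
    by_cases ha : a ∈ T
    · exact ⟨a, Walk.nil, ha, fun z hz _ => by simpa using hz,
        fun z hz => by rw [Walk.support_nil, List.mem_singleton] at hz; subst hz; simp, Or.inl rfl⟩
    · obtain ⟨d, W₁, hd, hfirst, hsub, hlast⟩ := Walk.exists_firstHit T W' hb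
      refine ⟨d, Walk.cons h W₁, hd, fun z hz hzT => ?_, fun z hz => ?_, Or.inr ?_⟩
      · rw [Walk.support_cons, List.mem_cons] at hz
        rcases hz with rfl | hz
        · exact absurd hzT ha
        · exact hfirst z hz hzT
      · rw [Walk.support_cons, List.mem_cons] at hz ⊢
        rcases hz with rfl | hz
        · exact Or.inl rfl
        · exact Or.inr (hsub z hz)
      · rcases hlast with rfl | ⟨p, hp, hpT, hpd⟩
        · exact ⟨a, by simp, ha, h⟩
        · exact ⟨p, by simp [hp], hpT, hpd⟩

/-! ### One side of a separation -/

section Side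

variable [Fintype V] [DecidableEq V]

variable (G) in
/-- The neighbours of a vertex set outside it (`N(X)`). [cite: Diestel2017, §1.1 (N(X))] -/
noncomputable def outNbrs (X : Finset V) : Finset V := by
  classical exact Finset.univ.filter fun u => u ∉ X ∧ ∃ v ∈ X, G.Adj u v

/-- Membership in `outNbrs`. [folklore] -/
theorem mem_outNbrs {X : Finset V} {u : V} : u ∈ outNbrs G X ↔ u ∉ X ∧ ∃ v ∈ X, G.Adj u v := by
  classical
  simp [outNbrs]

variable (G) in
/-- **One side of a minimum separation** (the data of (∗) in the proof of Diestel's Thm. 12.4.3,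
seen from the petal `X`): the open side `R ⊇ X`, closed under neighbours off the separator `S`,
and the minimality of `S` among the sets off `X` inside `R ∪ S` that separate `X` from the far
side `Rᶜ`. [cite: Diestel2017, Thm. 12.4.3 (proof: "choosing {A, B} of minimum order")] -/
structure SideData where
  /-- the petal -/
  X : Finset V
  /-- its open side -/
  R : Set V
  /-- the separator -/
  S : Finset V
  /-- the petal lies in the open side -/
  X_sub : ∀ ⦃v⦄, v ∈ X → v ∈ R
  /-- the open side avoids the separator -/
  not_mem_S : ∀ ⦃v⦄, v ∈ R → v ∉ S
  /-- the open side is closed under neighbours off the separator -/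
  mem_of_adj : ∀ ⦃u v⦄, u ∈ R → G.Adj u v → v ∉ S → v ∈ R
  /-- minimality of the separator -/
  card_le : ∀ Z : Finset V, (∀ z ∈ Z, z ∉ X ∧ (z ∈ R ∨ z ∈ S)) →
    (∀ ⦃a b⦄, a ∈ X → b ∉ R → ∀ W : G.Walk a b, ∃ z ∈ W.support, z ∈ Z) → S.card ≤ Z.card

namespace SideData

variable (Δ : SideData G)

omit [Fintype V] in
/-- A neighbour of the open side outside it lies in the separator. [folklore] -/
theorem mem_S_of_adj {u v : V} (hu : u ∈ Δ.R) (huv : G.Adj u v) (hv : v ∉ Δ.R) : v ∈ Δ.S := by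
  by_contra h
  exact hv (Δ.mem_of_adj hu huv h)

/-- `N(X) ⊆ R ∪ S`. [folklore] -/
theorem mem_or_mem_of_mem_outNbrs {u : V} (hu : u ∈ outNbrs G Δ.X) : u ∈ Δ.R ∨ u ∈ Δ.S := by
  obtain ⟨-, v, hv, huv⟩ := mem_outNbrs.1 hu
  by_cases h : u ∈ Δ.R
  · exact Or.inl h
  · exact Or.inr (Δ.mem_S_of_adj (Δ.X_sub hv) huv.symm h)

/-- **The Menger hypothesis on one side.** Every set separating the far side `Rᶜ` from `X ∪ N(X)`
has at least `|S|` vertices: from an `X`–`Rᶜ` walk one extracts an `N(X)`–`S` segment inside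
`R ∪ S` avoiding `X`, which such a set must meet. [cite: Diestel2017, Thm. 12.4.3 (proof: "By the
minimality of S and Menger's Theorem")] -/
theorem card_le_of_isVxSeparator (Z : Finset V)
    (hZ : IsVxSeparator G (Δ.R)ᶜ (↑(Δ.X ∪ outNbrs G Δ.X) : Set V) ↑Z) : Δ.S.card ≤ Z.card := by
  classical
  -- replace `Z` by its part off `X` inside `R ∪ S`
  set Z' : Finset V := Z.filter fun z => z ∉ Δ.X ∧ (z ∈ Δ.R ∨ z ∈ Δ.S) with hZ'
  refine le_trans (Δ.card_le Z' (fun z hz => (Finset.mem_filter.1 hz).2) ?_) (Finset.card_filter_le _ _)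
  intro a b ha hb W
  -- first vertex `d` of `W` outside `R`: it lies in `S`
  obtain ⟨d, W₁, hd, hfirst, hsub, hlast⟩ := Walk.exists_firstHit (Δ.R)ᶜ W hb
  have hdS : d ∈ Δ.S := by
    rcases hlast with rfl | ⟨p, -, hp, hpd⟩
    · exact absurd (Δ.X_sub ha) hd
    · exact Δ.mem_S_of_adj (not_not.1 hp) hpd hd
  -- then, backwards from `d`, the first vertex `c` of `X ∪ N(X)`: it lies in `N(X)`
  obtain ⟨c, W₂, hc, hfirst₂, hsub₂, hlast₂⟩ :=
    Walk.exists_firstHit (↑(Δ.X ∪ outNbrs G Δ.X) : Set V) W₁.reverse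
      (show a ∈ (↑(Δ.X ∪ outNbrs G Δ.X) : Set V) by simp [ha])
  have hcX : c ∉ Δ.X := by
    rcases hlast₂ with rfl | ⟨p, -, hp, hpc⟩
    · exact fun h => hd (Δ.X_sub h)
    · intro hcX
      apply hp
      have hpX : p ∉ Δ.X := fun h => hp (by simp [h])
      simp only [Finset.coe_union, Set.mem_union, Finset.mem_coe, mem_outNbrs]
      exact Or.inr ⟨hpX, c, hcX, hpc⟩
  -- `Z` meets the segment `W₂` (a walk from `d ∈ Rᶜ` to `c ∈ X ∪ N(X)`)
  obtain ⟨z, hz, hzZ⟩ := hZ hd hc W₂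
  have hz₁ : z ∈ W₁.support := by
    have := hsub₂ z hz
    rwa [Walk.support_reverse, List.mem_reverse] at this
  refine ⟨z, hsub z hz₁, Finset.mem_filter.2 ⟨hzZ, ?_, ?_⟩⟩
  · intro hzX
    have := hfirst₂ z hz (by simp [hzX])
    exact hcX (this ▸ hzX)
  · by_cases hzR : z ∈ Δ.R
    · exact Or.inl hzR
    · exact Or.inr ((hfirst z hz₁ hzR) ▸ hdS)

/-- The first vertex of a strict `Rᶜ`–`(X ∪ N(X))` path lies in `S`. [folklore] -/
theorem fst_mem_S {ι : Type u} (P : ABPathSystem G (Δ.R)ᶜ (↑(Δ.X ∪ outNbrs G Δ.X) : Set V) ι)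
    (i : ι) : P.fst i ∈ Δ.S := by
  have hf : P.fst i ∉ Δ.R := P.fst_mem i
  have hl : P.lst i ∈ (↑(Δ.X ∪ outNbrs G Δ.X) : Set V) := P.lst_mem i
  by_cases hlR : P.lst i ∈ Δ.R
  · obtain ⟨d, hd, hdR, hdR'⟩ := (P.walk i).reverse.exists_boundary_dart Δ.R hlR hf
    have hdS : d.toProd.2 ∈ Δ.S := Δ.mem_S_of_adj hdR d.adj hdR'
    have hmem : d.toProd.2 ∈ (P.walk i).support := by
      have := (P.walk i).reverse.dart_snd_mem_support_of_mem_darts hd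
      rwa [Walk.support_reverse, List.mem_reverse] at this
    rwa [P.eq_fst_of_mem i _ hmem hdR'] at hdS
  · have hlS : P.lst i ∈ Δ.S := by
      simp only [Finset.coe_union, Set.mem_union, Finset.mem_coe] at hl
      rcases hl with hl | hl
      · exact absurd (Δ.X_sub hl) hlR
      · exact (Δ.mem_or_mem_of_mem_outNbrs hl).resolve_left hlR
    rwa [P.eq_fst_of_mem i _ (P.walk i).end_mem_support hlR] at hlS

/-- **Menger on one side**: `|S|` disjoint paths from `S` into `N(X)`, inside `R ∪ S`, the path of
`s ∈ S` starting at `s` (strict `Rᶜ`–`(X ∪ N(X))` paths of `G`, re-indexed by their first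
vertices). [cite: Diestel2017, Thm. 12.4.3 (proof: "a family {P_s | s ∈ S} of disjoint S–N(X)
paths in G[A]"), Thm. 3.3.1 (Menger)] -/
theorem exists_paths :
    ∃ P : ABPathSystem G (Δ.R)ᶜ (↑(Δ.X ∪ outNbrs G Δ.X) : Set V) (↑Δ.S : Set V),
      ∀ s, P.fst s = s := by
  classical
  obtain ⟨ι, _, hcard, ⟨P₀⟩⟩ := exists_abPathSystem_of_forall_isVxSeparator G (Δ.R)ᶜ
    (↑(Δ.X ∪ outNbrs G Δ.X) : Set V) Δ.S.card Δ.card_le_of_isVxSeparator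
  exact P₀.exists_reindex_fst Δ.S (Δ.fst_mem_S P₀) hcard

section Paths

variable {Δ}
variable (P : ABPathSystem G (Δ.R)ᶜ (↑(Δ.X ∪ outNbrs G Δ.X) : Set V) (↑Δ.S : Set V))
  (hP : ∀ s, P.fst s = s)
include hP

/-- The paths run inside `R ∪ {s}`. [cite: Diestel2017, Thm. 12.4.3 (proof)] -/
theorem eq_of_mem_support_of_not_mem {s : (↑Δ.S : Set V)} {z : V} (hz : z ∈ (P.walk s).support)
    (hzR : z ∉ Δ.R) : z = s :=
  (P.eq_fst_of_mem s z hz hzR).trans (hP s)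

omit hP in
/-- The paths end in `N(X)`, not in `X`. [cite: Diestel2017, Thm. 12.4.3 (proof)] -/
theorem lst_not_mem_X (s : (↑Δ.S : Set V)) : P.lst s ∉ Δ.X := by
  intro hl
  have hsX : P.fst s ∉ Δ.X := fun h => Δ.not_mem_S (Δ.X_sub h) (Δ.fst_mem_S P s)
  obtain ⟨d, hd, hd₁, hd₂⟩ := (P.walk s).exists_boundary_dart (↑Δ.X)ᶜ hsX (by simpa using hl)
  have hd₂' : d.toProd.2 ∈ Δ.X := by simpa using hd₂
  have hN : d.toProd.1 ∈ outNbrs G Δ.X := mem_outNbrs.2 ⟨hd₁, _, hd₂', d.adj⟩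
  have h1 : d.toProd.1 = P.lst s := P.eq_lst_of_mem s _
    ((P.walk s).dart_fst_mem_support_of_mem_darts hd) (by simp [hN])
  have h2 : d.toProd.2 = P.lst s := P.eq_lst_of_mem s _
    ((P.walk s).dart_snd_mem_support_of_mem_darts hd) (by simp [hd₂'])
  exact d.adj.ne (h1.trans h2.symm)

omit hP in
/-- The paths end in `N(X)`. [cite: Diestel2017, Thm. 12.4.3 (proof)] -/
theorem lst_mem_outNbrs (s : (↑Δ.S : Set V)) : P.lst s ∈ outNbrs G Δ.X := by
  have hl : P.lst s ∈ (↑(Δ.X ∪ outNbrs G Δ.X) : Set V) := P.lst_mem s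
  simp only [Finset.coe_union, Set.mem_union, Finset.mem_coe] at hl
  exact hl.resolve_left (lst_not_mem_X P s)

omit hP in
/-- The paths avoid `X`. [cite: Diestel2017, Thm. 12.4.3 (proof)] -/
theorem not_mem_X_of_mem_support {s : (↑Δ.S : Set V)} {z : V} (hz : z ∈ (P.walk s).support) :
    z ∉ Δ.X := by
  intro hzX
  have := P.eq_lst_of_mem s z hz (by simp [hzX])
  exact lst_not_mem_X P s (this ▸ hzX)

end Paths


/-! ### The half decomposition on one side -/

section Half

variable {ι : Type*} {Δ}
variable (D : TreeDecomposition G ι)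
  (P : ABPathSystem G (Δ.R)ᶜ (↑(Δ.X ∪ outNbrs G Δ.X) : Set V) (↑Δ.S : Set V))

/-- The node set of the path of `s`: the nodes whose bag meets it. [cite: Diestel2017, Thm. 12.4.3
(proof, (1))] -/
def pathNodes (s : (↑Δ.S : Set V)) : Set ι := {t | ∃ v ∈ D.bag t, v ∈ (P.walk s).support}

/-- **The new bags** `V'_t := (V_t ∩ B) ∪ {s ∈ S | V_t meets P_s}` ((1) in Diestel's proof; the
decomposition induced on the minor obtained by contracting the paths `P_s`).
[cite: Diestel2017, Thm. 12.4.3 (proof, (1))] -/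
noncomputable def halfBag (t : ι) : Finset V := by
  classical exact Finset.univ.filter fun v =>
    (v ∈ D.bag t ∧ v ∉ Δ.R) ∨ ∃ h : v ∈ Δ.S, t ∈ pathNodes D P ⟨v, h⟩

variable {D P}

/-- Membership in the new bags. [folklore] -/
theorem mem_halfBag {t : ι} {v : V} :
    v ∈ halfBag D P t ↔ (v ∈ D.bag t ∧ v ∉ Δ.R) ∨ ∃ h : v ∈ Δ.S, t ∈ pathNodes D P ⟨v, h⟩ := by
  classical
  simp [halfBag]

/-- The new bags lie in the closed far side `Rᶜ`. [cite: Diestel2017, Thm. 12.4.3 (proof)] -/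
theorem not_mem_R_of_mem_halfBag {t : ι} {v : V} (hv : v ∈ halfBag D P t) : v ∉ Δ.R := by
  rcases mem_halfBag.1 hv with ⟨-, h⟩ | ⟨h, -⟩
  · exact h
  · exact fun hR => Δ.not_mem_S hR h

/-- For a vertex off `S`, membership in the new bags is membership in the old ones (off `R`).
[folklore] -/
theorem mem_halfBag_of_not_mem_S {t : ι} {v : V} (hvS : v ∉ Δ.S) :
    v ∈ halfBag D P t ↔ v ∈ D.bag t ∧ v ∉ Δ.R := by
  rw [mem_halfBag]
  exact ⟨fun h => h.elim id fun ⟨h, _⟩ => absurd h hvS, Or.inl⟩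

variable (hP : ∀ s, P.fst s = s)
include hP

/-- For `s ∈ S`, the nodes whose new bag contains `s` are the nodes of the path of `s`.
[cite: Diestel2017, Thm. 12.4.3 (proof)] -/
theorem mem_halfBag_iff_of_mem_S {t : ι} {s : V} (hs : s ∈ Δ.S) :
    s ∈ halfBag D P t ↔ t ∈ pathNodes D P ⟨s, hs⟩ := by
  rw [mem_halfBag]
  constructor
  · rintro (⟨hst, -⟩ | ⟨_, h⟩)
    · exact ⟨s, hst, Walk.mem_support_of_eq_start (P.walk ⟨s, hs⟩) (hP ⟨s, hs⟩)⟩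
    · exact h
  · exact fun h => Or.inr ⟨hs, h⟩

omit hP in
/-- The nodes of a path are pairwise linked through themselves. [cite: Diestel2017, Lemma 12.3.1
(with the proof of Lemma 12.3.3)] -/
theorem linked_pathNodes (s : (↑Δ.S : Set V)) {a b : ι} (ha : a ∈ pathNodes D P s)
    (hb : b ∈ pathNodes D P s) : Linked D.tree (pathNodes D P s) a b := by
  obtain ⟨a₀, ha₀⟩ := D.exists_mem_bag (P.fst s)
  have key : ∀ c ∈ pathNodes D P s, Linked D.tree (pathNodes D P s) a₀ c := by
    rintro c ⟨z, hzc, hz⟩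
    have h := D.linked_of_walk (P.walk s) ha₀ ⟨z, hz, hzc⟩
    exact h.mono fun t ⟨z, hz, hzt⟩ => ⟨z, hzt, hz⟩
  exact (key a ha).symm.trans (key b hb)

/-- **(T3) for the new bags**: the node set of every vertex is linked through itself.
[cite: Diestel2017, Thm. 12.4.3 (proof: "(T₁, 𝒱'₁) … is a tree-decomposition of G[B]")] -/
theorem linked_halfBag (v : V) {a b : ι} (ha : v ∈ halfBag D P a) (hb : v ∈ halfBag D P b) :
    Linked D.tree {t | v ∈ halfBag D P t} a b := by
  by_cases hvS : v ∈ Δ.S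
  · have hset : {t | v ∈ halfBag D P t} = pathNodes D P ⟨v, hvS⟩ :=
      Set.ext fun t => mem_halfBag_iff_of_mem_S hP hvS
    rw [hset]
    rw [mem_halfBag_iff_of_mem_S hP hvS] at ha hb
    exact linked_pathNodes _ ha hb
  · have hset : {t | v ∈ halfBag D P t} = {t | v ∈ D.bag t} := by
      ext t
      rw [Set.mem_setOf_eq, mem_halfBag_of_not_mem_S hvS]
      exact ⟨fun h => h.1, fun h => ⟨h, not_mem_R_of_mem_halfBag ha⟩⟩
    rw [hset]
    exact D.linked v ((mem_halfBag_of_not_mem_S hvS).1 ha).1 ((mem_halfBag_of_not_mem_S hvS).1 hb).1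

omit hP in
/-- **(T2) for the new bags** on the closed far side. [cite: Diestel2017, Thm. 12.4.3 (proof)] -/
theorem exists_mem_halfBag_of_adj {u v : V} (huv : G.Adj u v) (hu : u ∉ Δ.R) (hv : v ∉ Δ.R) :
    ∃ t, u ∈ halfBag D P t ∧ v ∈ halfBag D P t := by
  obtain ⟨t, hut, hvt⟩ := D.exists_mem_bag_of_adj huv
  exact ⟨t, mem_halfBag.2 (Or.inl ⟨hut, hu⟩), mem_halfBag.2 (Or.inl ⟨hvt, hv⟩)⟩

omit hP in
/-- **(T1) for the new bags** on the closed far side. [cite: Diestel2017, Thm. 12.4.3 (proof)] -/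
theorem exists_mem_halfBag {v : V} (hv : v ∉ Δ.R) : ∃ t, v ∈ halfBag D P t := by
  obtain ⟨t, hvt⟩ := D.exists_mem_bag v
  exact ⟨t, mem_halfBag.2 (Or.inl ⟨hvt, hv⟩)⟩

/-- **The new bags are no larger than the old ones**: every `s ∈ V'_t ∖ V_t` is represented by a
vertex of `P_s` in `V_t ∖ B`, injectively as the paths are disjoint.
[cite: Diestel2017, Thm. 12.4.3 (proof: "by (1), there exists for every s ∈ V_t ∖ V_t^1 a
vertex of P_s in V_t^1 ∖ V_t")] -/
theorem card_halfBag_le (t : ι) : (halfBag D P t).card ≤ (D.bag t).card := by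
  classical
  -- split the new bag into its part inside the old bag and the new vertices `s`
  have hsplit : halfBag D P t =
      (D.bag t).filter (fun v => v ∉ Δ.R) ∪ (halfBag D P t).filter (fun v => v ∉ D.bag t) := by
    ext v
    simp only [Finset.mem_union, Finset.mem_filter, mem_halfBag]
    constructor
    · intro h
      by_cases hvt : v ∈ D.bag t
      · rcases h with ⟨-, hR⟩ | ⟨hS, -⟩
        · exact Or.inl ⟨hvt, hR⟩
        · exact Or.inl ⟨hvt, fun hR => Δ.not_mem_S hR hS⟩
      · exact Or.inr ⟨h, hvt⟩
    · rintro (⟨hvt, hR⟩ | ⟨h, -⟩)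
      · exact Or.inl ⟨hvt, hR⟩
      · exact h
  -- the new vertices are `s ∈ S` whose path meets the old bag, at a vertex of `V_t ∩ R`
  have hnew : ∀ v ∈ (halfBag D P t).filter (fun v => v ∉ D.bag t),
      ∃ h : v ∈ Δ.S, ∃ w ∈ D.bag t, w ∈ (P.walk ⟨v, h⟩).support ∧ w ∈ Δ.R := by
    intro v hv
    rw [Finset.mem_filter, mem_halfBag] at hv
    obtain ⟨⟨hvt, -⟩ | ⟨hS, w, hwt, hw⟩, hvt'⟩ := hv
    · exact absurd hvt hvt'
    · refine ⟨hS, w, hwt, hw, ?_⟩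
      by_contra hwR
      have hws : w = v := eq_of_mem_support_of_not_mem P hP hw hwR
      exact hvt' (hws ▸ hwt)
  choose! hS f hft hfw hfR using hnew
  have hinj : Set.InjOn f ↑((halfBag D P t).filter (fun v => v ∉ D.bag t)) := by
    intro v hv v' hv' hvv'
    have h1 := hfw v hv
    have h2 := hfw v' hv'
    rw [hvv'] at h1
    by_contra hne
    have hne' : (⟨v, hS v hv⟩ : (↑Δ.S : Set V)) ≠ ⟨v', hS v' hv'⟩ := fun h => hne (by simpa using h)
    exact P.disjoint _ _ hne' h1 h2
  have hmaps : Set.MapsTo f ↑((halfBag D P t).filter (fun v => v ∉ D.bag t))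
      ↑((D.bag t).filter (fun v => v ∈ Δ.R)) := by
    intro v hv
    simp only [Finset.coe_filter, Set.mem_setOf_eq]
    exact ⟨hft v hv, hfR v hv⟩
  have hcard := Finset.card_le_card_of_injOn f hmaps hinj
  have hdisj : Disjoint ((D.bag t).filter (fun v => v ∉ Δ.R))
      ((halfBag D P t).filter (fun v => v ∉ D.bag t)) := by
    rw [Finset.disjoint_left]
    intro v hv hv'
    exact (Finset.mem_filter.1 hv').2 (Finset.mem_filter.1 hv).1
  rw [hsplit, Finset.card_union_of_disjoint hdisj]
  calc ((D.bag t).filter (fun v => v ∉ Δ.R)).card + ((halfBag D P t).filter (fun v => v ∉ D.bag t)).card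
      ≤ ((D.bag t).filter (fun v => v ∉ Δ.R)).card + ((D.bag t).filter (fun v => v ∈ Δ.R)).card :=
        Nat.add_le_add_left hcard _
    _ = (D.bag t).card := by
        rw [add_comm, Finset.card_filter_add_card_filter_not]

end Half

/-! ### The half decomposition at the petal's leaf -/

section Leaf

variable {ι : Type*} {Δ}
variable {D : TreeDecomposition G ι}
  {P : ABPathSystem G (Δ.R)ᶜ (↑(Δ.X ∪ outNbrs G Δ.X) : Set V) (↑Δ.S : Set V)}
  {x x' : ι} (hX : Δ.X = D.bag x \ D.bag x')
include hX

/-- `N(X) ⊆ V_x`. [cite: Diestel2017, Thm. 12.4.3 (proof)] -/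
theorem outNbrs_subset_bag (hx : IsLeafAt D.tree x x') {u : V} (hu : u ∈ outNbrs G Δ.X) :
    u ∈ D.bag x := by
  obtain ⟨-, v, hv, huv⟩ := mem_outNbrs.1 hu
  rw [hX] at hv
  exact TreeDecomposition.mem_bag_of_adj_of_mem_sdiff' hx hv huv

/-- `N(X) ⊆ V_{x'}`, hence `|N(X)| ≤ |V_{x'}|`. [cite: Diestel2017, Thm. 12.4.3 (proof)] -/
theorem outNbrs_subset_bag' (hx : IsLeafAt D.tree x x') {u : V} (hu : u ∈ outNbrs G Δ.X) :
    u ∈ D.bag x' := by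
  have hux := outNbrs_subset_bag hX hx hu
  obtain ⟨huX, v, hv, huv⟩ := mem_outNbrs.1 hu
  rw [hX] at hv huX
  exact (TreeDecomposition.mem_bag_of_adj_of_mem_sdiff hx hv huv huX).2

/-- The leaf `x` is a node of every path `P_s` (the path ends in `N(X) ⊆ V_x`).
[cite: Diestel2017, Thm. 12.4.3 (proof: "N(X) meets every P_s")] -/
theorem mem_pathNodes_leaf (hx : IsLeafAt D.tree x x') (s : (↑Δ.S : Set V)) :
    x ∈ pathNodes D P s :=
  ⟨P.lst s, outNbrs_subset_bag hX hx (SideData.lst_mem_outNbrs P s), (P.walk s).end_mem_support⟩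

/-- **The new bag at the leaf is exactly `S`** (`V'_x = S`), provided the leaf bag was trimmed to
`X ∪ N(X)`. [cite: Diestel2017, Thm. 12.4.3 (proof: "In particular, V_x = S")] -/
theorem halfBag_leaf (hx : IsLeafAt D.tree x x') (htrim : ∀ u ∈ D.bag x, u ∈ Δ.X ∨ u ∈ outNbrs G Δ.X) :
    halfBag D P x = Δ.S := by
  ext v
  rw [mem_halfBag]
  constructor
  · rintro (⟨hvx, hvR⟩ | ⟨hS, -⟩)
    · rcases htrim v hvx with h | h
      · exact absurd (Δ.X_sub h) hvR
      · exact (Δ.mem_or_mem_of_mem_outNbrs h).resolve_left hvR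
    · exact hS
  · intro hvS
    exact Or.inr ⟨hvS, mem_pathNodes_leaf hX hx ⟨v, hvS⟩⟩

/-- **Petals of the new bags**: at a leaf `z ≠ x` (neighbour `z'`), a vertex of `V'_z ∖ V'_{z'}`
lies off `R ∪ S` and in the old petal `V_z ∖ V_{z'}`. (A vertex `s ∈ S` of `V'_z` has `z` on
its path, whose node set is linked, contains `x`, hence the neighbour `z'` of the leaf `z`.)
[cite: Diestel2017, Thm. 12.4.3 (proof: "Z ∩ S = ∅ … Z lies inside the petal Z₁ of z in
(T₁, 𝒱₁)")] -/
theorem mem_of_mem_halfBag_sdiff (hP : ∀ s, P.fst s = s) (hx : IsLeafAt D.tree x x') {z z' : ι}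
    (hz : IsLeafAt D.tree z z')
    (hzx : z ≠ x) {v : V} (hv : v ∈ halfBag D P z \ halfBag D P z') :
    v ∉ Δ.R ∧ v ∉ Δ.S ∧ v ∈ D.bag z \ D.bag z' := by
  rw [Finset.mem_sdiff] at hv
  obtain ⟨hvz, hvz'⟩ := hv
  have hvR := not_mem_R_of_mem_halfBag hvz
  have hvS : v ∉ Δ.S := by
    intro hvS
    rw [mem_halfBag_iff_of_mem_S hP hvS] at hvz hvz'
    have hl := linked_pathNodes (D := D) (P := P) ⟨v, hvS⟩ hvz (mem_pathNodes_leaf hX hx ⟨v, hvS⟩)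
    exact hvz' (hz.mem_of_linked hl hzx.symm)
  refine ⟨hvR, hvS, Finset.mem_sdiff.2 ⟨((mem_halfBag_of_not_mem_S hvS).1 hvz).1, fun h => ?_⟩⟩
  exact hvz' ((mem_halfBag_of_not_mem_S hvS).2 ⟨h, hvR⟩)

end Leaf

end SideData

end Side

end Literature.Combinatorics.SimpleGraph
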